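import Summits.CriticalPhenomena.PercolationContinuityZ3.Theorems.PercNearOneGluingNoHeavyQuantSDEC
import HarnessLib

/-!
# QUANT lane R8, the gated ("phantom") heavy node: ITS FIRST ROW IS A ONE-LINE MARKOV INEQUALITY — for EVERY floor
# `0 < y < 1` and gate `0 < q ≤ 1`, the two-layer bounds of `gate (lconv μ₁ μ₂) q` at the pairs `(i, 0)` (equivalently the
# `d = 0` row of its `TLB` family) follow from the two MEANS and TOP-AFFORDABILITY alone — no reflection hypothesis on either factor

builds on p205010 (kernel theorem, internal audit signed; external expert review pending)

Support file (`--supports stmt-CriticalPhenomena-4575`), QUANT lane LEAD seat prim-quant-lead (gen 38), rung R8 of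
`run/shared/lean/prim/quant/LADDER.md`; lane finding V369 (`README.md`), memo
`run/shared/lean/prim/quant/prim-quant-lead-g38/PHANTOM-G38.md` §1.  Theorems only, standard axioms, no sorries; imports only
`…QuantSDEC` (census-2 g53: `gate`, `lconv`, `sum_lconv`, `sum_mul_lconv`, `lconv_nonneg`).

THE OBSERVATION.  In the notation of `…QuantTLBClosure` / `…QuantTwoLayerClosure` (floor `y`, rate `u = y/(1−y)`, gate `q`,
surplus `ε = u(1−q)/q`, laws `μ₁`, `μ₂` on `{0..M₁}`, `{0..M₂}` with means `T₁`, `T₂`, targets `tᵢ = q·Tᵢ`, top-affordability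
`y·Mᵢ ≤ tᵢ`, `S = X₁ + X₂`, `t = t₁ + t₂`, `T = T₁ + T₂`), the `d = 0` row of the conclusion of the heavy node
`LawDec.TLBGateConvClosedHeavy` (lead g37, `…QuantTLBClosureHeavy`) reads `P(S ≥ t) ≥ u·P(S = 0) + ε`.  It holds for EVERY `y ∈ (0,1)`
(not only the heavy half) and uses NO two-layer hypothesis on the factors: with `Z := S − t` one has `E Z = T − t = εt/u` (means) and
`Z ≤ M₁ + M₂ − t ≤ t/y − t = t/u` (top-affordability), hence `εt/u = E Z ≤ (t/u)·P(S ≥ t) − t·P(S = 0) + 0·P(0 < S < t)`, i.e. the row.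
As a pointwise certificate: the single GLOBAL MEAN TILT `(y/T)·(n − T) ≤ K_{i,0}(n) := (1−y)q·[i+1 ≤ n] − yq·[n ≤ 0] − y(1−q)` on
`0 ≤ n ≤ M₁ + M₂` — three linear cases (`n = 0`; `0 < n ≤ i`, using `i < qT`; `n ≥ i+1`, using `y(M₁+M₂) ≤ qT`) — integrated against
`lconv μ₁ μ₂` (mass `1`, mean `T`).  This supersedes lead g37's one-reflection certificate "D0T" for the same row (V367; valid, unnecessary).

* `LawDec.kernel_ge_globalTilt` — the pointwise inequality.
* `LawDec.lconv_pair_zero_functional` — its integral: `yq·lconv(0) + y(1−q) ≤ (1−y)q·Σ_{h ≥ i+1} lconv(h)` for `i < q(T₁+T₂)`.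
* `LawDec.twoLayer_gateConv_pair_zero` — the two-layer bound of `gate (lconv M₁ M₂ μ₁ μ₂) q` at every pair `(i, 0)` with `i < q(T₁+T₂)`
  (the shape of arm-2 g38's `LawDec.TwoLayer` pairs with `i′ = 0`), from nonnegativity, mass `1` and top-affordability of both factors only.
* `LawDec.tlb_gateConv_row_zero` — the same in the shape of the `d = 0` instance of
  `TLB (y/(1−y)) (q(T₁+T₂)) (M₁+M₂) (gate (lconv M₁ M₂ μ₁ μ₂) q)` (the conclusion of `TLBGateConvClosed[Heavy]`, `…QuantTLBClosure[Heavy]`).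

HONEST STATUS: one row of an OPEN node (`TLBGateConvClosedHeavy`: rows `d ≥ 1` for `q < 1` remain open; `q = 1` is arm-2 g38's Theorem A);
`FarTreeRowHeavy` / `FarTreeRow` OPEN; nothing here is a published result; the RATE class log\* and the honest sentence of
`run/shared/lean/prim/quant/README.md` are unchanged.

[this work].  The gluing rows served [cite: KozmaNitzan2024, Conjecture 3 (p. 15)]; product measure [cite: Grimmett1999, §1.3 p. 10].
-/

noncomputable section

namespace Summit.CriticalPhenomena.PercolationContinuityZ3.Theorems

namespace Quant

open Finset

namespace LawDec

/-- **the pointwise certificate** (scaled by `T`): for `0 < y`, `q ≤ 1`, `0 < T`, an index `i` with `i < q·T`, and a grid point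
`n ≤ N` with `y·N ≤ q·T` (top-affordability; no sign condition on `T` is needed), `y·(n − T) ≤ T·K_{i,0}(n)` where
`K_{i,0}(n) = (1−y)q·[i+1 ≤ n] − yq·[n ≤ 0] − y(1−q)` — i.e. the global mean tilt `(y/T)(n − T)` lies below the kernel. [this work] -/
theorem kernel_ge_globalTilt (y q T : ℝ) (i N n : ℕ) (hy0 : 0 < y)
    (hi : (i : ℝ) < q * T) (hN : y * (N : ℝ) ≤ q * T) (hn : n ≤ N) :
    y * ((n : ℝ) - T)
      ≤ T * ((1 - y) * q * (if i + 1 ≤ n then (1 : ℝ) else 0) - y * q * (if n ≤ 0 then (1 : ℝ) else 0) - y * (1 - q)) := by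
  have hnN : (n : ℝ) ≤ N := by exact_mod_cast hn
  by_cases hn0 : n ≤ 0
  · -- `n = 0`: `−yT ≤ T(−yq − y(1−q)) = −yT`
    have : n = 0 := by omega
    subst this
    rw [if_neg (by omega), if_pos le_rfl]
    simp only [Nat.cast_zero, zero_sub, mul_zero, mul_one]
    nlinarith
  · rw [if_neg hn0]
    by_cases htop : i + 1 ≤ n
    · -- target cells: `y·n − yT ≤ T((1−y)q − y(1−q)) = T(q − y)`, from `y·n ≤ y·N ≤ qT`
      rw [if_pos htop]
      nlinarith
    · -- middle cells `0 < n ≤ i < qT`: `y·n − yT ≤ −yT(1−q)`, i.e. `y·n ≤ y·qT`, from `n ≤ i < qT`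
      rw [if_neg htop]
      have hni : (n : ℝ) ≤ i := by exact_mod_cast (by omega : n ≤ i)
      nlinarith [mul_le_mul_of_nonneg_left (le_of_lt (lt_of_le_of_lt hni hi)) hy0.le]

/-- **integrated certificate**: for `μ₁`, `μ₂` nonnegative laws of mass `1` on `{0..M₁}`, `{0..M₂}` with means `T₁`, `T₂`, `0 < y`,
top-affordable in total (`y(M₁+M₂) ≤ q(T₁+T₂)`, e.g. from `y·Mᵢ ≤ q·Tᵢ`) and `i < q(T₁+T₂)`:
`yq·lconv(0) + y(1−q) ≤ (1−y)q·Σ_{h ≤ M₁+M₂, i+1 ≤ h} lconv(h)`. [this work] -/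
theorem lconv_pair_zero_functional (y q : ℝ) (M₁ M₂ : ℕ) (μ₁ μ₂ : ℕ → ℝ) (hy0 : 0 < y)
    (h10 : ∀ h, 0 ≤ μ₁ h) (h11 : ∑ h ∈ Finset.range (M₁ + 1), μ₁ h = 1)
    (h20 : ∀ h, 0 ≤ μ₂ h) (h21 : ∑ h ∈ Finset.range (M₂ + 1), μ₂ h = 1)
    (hta : y * ((M₁ : ℝ) + M₂) ≤ q * ((∑ h ∈ Finset.range (M₁ + 1), (h : ℝ) * μ₁ h) + ∑ h ∈ Finset.range (M₂ + 1), (h : ℝ) * μ₂ h))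
    (i : ℕ) (hi : (i : ℝ) < q * ((∑ h ∈ Finset.range (M₁ + 1), (h : ℝ) * μ₁ h) + ∑ h ∈ Finset.range (M₂ + 1), (h : ℝ) * μ₂ h)) :
    y * q * lconv M₁ M₂ μ₁ μ₂ 0 + y * (1 - q)
      ≤ (1 - y) * q * ∑ h ∈ Finset.range (M₁ + M₂ + 1), (if i + 1 ≤ h then lconv M₁ M₂ μ₁ μ₂ h else 0) := by
  set T₁ : ℝ := ∑ h ∈ Finset.range (M₁ + 1), (h : ℝ) * μ₁ h with hT₁
  set T₂ : ℝ := ∑ h ∈ Finset.range (M₂ + 1), (h : ℝ) * μ₂ h with hT₂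
  set L : ℕ → ℝ := lconv M₁ M₂ μ₁ μ₂ with hL
  have hmass : ∑ h ∈ Finset.range (M₁ + M₂ + 1), L h = 1 := sum_lconv M₁ M₂ μ₁ μ₂ h11 h21
  have hmean : ∑ h ∈ Finset.range (M₁ + M₂ + 1), (h : ℝ) * L h = T₁ + T₂ := sum_mul_lconv M₁ M₂ μ₁ μ₂ h11 h21
  have hLnn : ∀ h, 0 ≤ L h := fun h => lconv_nonneg M₁ M₂ μ₁ μ₂ h10 h20 h
  -- the total mean is positive: `0 ≤ i < q(T₁+T₂)` and `T₁ + T₂ ≥ 0`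
  have hTpos : 0 < T₁ + T₂ := by
    have hT1nn : 0 ≤ T₁ := Finset.sum_nonneg fun h _ => mul_nonneg (Nat.cast_nonneg h) (h10 h)
    have hT2nn : 0 ≤ T₂ := Finset.sum_nonneg fun h _ => mul_nonneg (Nat.cast_nonneg h) (h20 h)
    rcases (show 0 ≤ T₁ + T₂ by linarith).eq_or_lt with heq | hlt
    · exfalso
      rw [← heq, mul_zero] at hi
      exact (not_lt.2 (Nat.cast_nonneg i)) hi
    · exact hlt
  have hN : y * ((M₁ + M₂ : ℕ) : ℝ) ≤ q * (T₁ + T₂) := by push_cast; linarith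
  -- integrate the pointwise certificate against `L ≥ 0`
  set G : ℕ → ℝ := fun h =>
    (1 - y) * q * (if i + 1 ≤ h then (1 : ℝ) else 0) - y * q * (if h ≤ 0 then (1 : ℝ) else 0) - y * (1 - q) with hG
  have hpt : ∀ h ∈ Finset.range (M₁ + M₂ + 1), L h * (y * ((h : ℝ) - (T₁ + T₂))) ≤ L h * ((T₁ + T₂) * G h) := by
    intro h hh
    rw [Finset.mem_range] at hh
    exact mul_le_mul_of_nonneg_left (kernel_ge_globalTilt y q (T₁ + T₂) i (M₁ + M₂) h hy0 hi hN (by omega)) (hLnn h)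
  have htilt : ∑ h ∈ Finset.range (M₁ + M₂ + 1), L h * (y * ((h : ℝ) - (T₁ + T₂))) = 0 := by
    have e : ∀ h : ℕ, L h * (y * ((h : ℝ) - (T₁ + T₂))) = y * ((h : ℝ) * L h) - (y * (T₁ + T₂)) * L h := by
      intro h; ring
    simp_rw [e]
    rw [Finset.sum_sub_distrib, ← Finset.mul_sum, ← Finset.mul_sum, hmean, hmass]
    ring
  have hint : 0 ≤ (T₁ + T₂) * ∑ h ∈ Finset.range (M₁ + M₂ + 1), L h * G h := by
    rw [Finset.mul_sum]
    calc (0 : ℝ) = ∑ h ∈ Finset.range (M₁ + M₂ + 1), L h * (y * ((h : ℝ) - (T₁ + T₂))) := htilt.symm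
      _ ≤ ∑ h ∈ Finset.range (M₁ + M₂ + 1), L h * ((T₁ + T₂) * G h) := Finset.sum_le_sum hpt
      _ = ∑ h ∈ Finset.range (M₁ + M₂ + 1), (T₁ + T₂) * (L h * G h) := Finset.sum_congr rfl fun h _ => by ring
  have hint' : 0 ≤ ∑ h ∈ Finset.range (M₁ + M₂ + 1), L h * G h := by
    by_contra hneg
    have : (T₁ + T₂) * ∑ h ∈ Finset.range (M₁ + M₂ + 1), L h * G h < 0 := mul_neg_of_pos_of_neg hTpos (not_le.1 hneg)
    linarith
  -- expand the integral: three sums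
  have e3 : ∀ h : ℕ, L h * G h
      = (1 - y) * q * (if i + 1 ≤ h then L h else 0) - y * q * (if h ≤ 0 then L h else 0) - y * (1 - q) * L h := by
    intro h
    simp only [hG]
    split_ifs <;> ring
  simp_rw [e3] at hint'
  rw [Finset.sum_sub_distrib, Finset.sum_sub_distrib, ← Finset.mul_sum, ← Finset.mul_sum, ← Finset.mul_sum, hmass] at hint'
  have h0sum : ∑ h ∈ Finset.range (M₁ + M₂ + 1), (if h ≤ 0 then L h else 0) = L 0 := by
    rw [Finset.sum_eq_single 0 (fun h _ hne => if_neg (by omega)) (fun hno => (hno (Finset.mem_range.2 (by omega))).elim)]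
    rw [if_pos le_rfl]
  rw [h0sum] at hint'
  linarith

/-- **THE `(i, 0)` PAIRS OF THE GATED CONVOLUTION NEED NO REFLECTIONS.**  `0 < y` (any gate `q`); `μ₁`, `μ₂` nonnegative laws of mass `1`
on `{0..M₁}`, `{0..M₂}` with means `T₁`, `T₂` whose gated versions are top-affordable (`y·Mᵢ ≤ q·Tᵢ`); then for every `i` with
`i < q(T₁+T₂)`:  `y · Σ_{h ≤ 0} ν h ≤ (1 − y) · Σ_{h ≥ i+1} ν h` for `ν = gate (lconv M₁ M₂ μ₁ μ₂) q` — the pair `(i, 0)` of arm-2 g38's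
two-layer family `LawDec.TwoLayer y (q(T₁+T₂)) (M₁+M₂) ν`. [this work] -/
theorem twoLayer_gateConv_pair_zero (y q : ℝ) (M₁ M₂ : ℕ) (μ₁ μ₂ : ℕ → ℝ) (hy0 : 0 < y)
    (h10 : ∀ h, 0 ≤ μ₁ h) (h11 : ∑ h ∈ Finset.range (M₁ + 1), μ₁ h = 1)
    (hta1 : y * (M₁ : ℝ) ≤ q * ∑ h ∈ Finset.range (M₁ + 1), (h : ℝ) * μ₁ h)
    (h20 : ∀ h, 0 ≤ μ₂ h) (h21 : ∑ h ∈ Finset.range (M₂ + 1), μ₂ h = 1)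
    (hta2 : y * (M₂ : ℝ) ≤ q * ∑ h ∈ Finset.range (M₂ + 1), (h : ℝ) * μ₂ h)
    (i : ℕ) (hi : (i : ℝ) < q * ((∑ h ∈ Finset.range (M₁ + 1), (h : ℝ) * μ₁ h) + ∑ h ∈ Finset.range (M₂ + 1), (h : ℝ) * μ₂ h)) :
    y * ∑ h ∈ Finset.range (M₁ + M₂ + 1), (if h ≤ 0 then gate (lconv M₁ M₂ μ₁ μ₂) q h else 0)
      ≤ (1 - y) * ∑ h ∈ Finset.range (M₁ + M₂ + 1), (if i + 1 ≤ h then gate (lconv M₁ M₂ μ₁ μ₂) q h else 0) := by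
  set L : ℕ → ℝ := lconv M₁ M₂ μ₁ μ₂ with hL
  have key := lconv_pair_zero_functional y q M₁ M₂ μ₁ μ₂ hy0 h10 h11 h20 h21 (by linarith) i hi
  -- left side: only `h = 0` survives, `gate L q 0 = q·L 0 + (1 − q)`
  have hLHS : ∑ h ∈ Finset.range (M₁ + M₂ + 1), (if h ≤ 0 then gate L q h else 0) = q * L 0 + (1 - q) := by
    rw [Finset.sum_eq_single 0 (fun h _ hne => if_neg (by omega)) (fun hno => (hno (Finset.mem_range.2 (by omega))).elim)]
    rw [if_pos le_rfl]
    simp [gate]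
  -- right side: `h ≥ i + 1 ≥ 1`, so the phantom atom does not contribute
  have hRHS : ∑ h ∈ Finset.range (M₁ + M₂ + 1), (if i + 1 ≤ h then gate L q h else 0)
      = q * ∑ h ∈ Finset.range (M₁ + M₂ + 1), (if i + 1 ≤ h then L h else 0) := by
    rw [Finset.mul_sum]
    refine Finset.sum_congr rfl fun h _ => ?_
    split_ifs with hh
    · simp only [gate]
      rw [if_neg (by omega)]
      ring
    · ring
  rw [hLHS, hRHS]
  have hq01 : y * (1 - q) = y - y * q := by ring
  nlinarith [key]

/-- **THE `d = 0` ROW OF THE GATED `TLB` FAMILY** (the shape of `TLBGateConvClosed[Heavy]`'s conclusion at `d = 0`): for `0 < y < 1`,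
any gate `q`, laws as above with top-affordable gated versions, and `0 < q(T₁+T₂)` (the row's own side condition `2·0 < τ`):
`(y/(1−y)) · Σ_{h ≤ 0} ν h ≤ Σ_{h ≤ M₁+M₂, q(T₁+T₂) − 0 ≤ h} ν h`, `ν = gate (lconv M₁ M₂ μ₁ μ₂) q`.  No reflection hypothesis on the
factors is needed, and `y ≥ 1/2` is NOT needed. [this work] -/
theorem tlb_gateConv_row_zero (y q : ℝ) (M₁ M₂ : ℕ) (μ₁ μ₂ : ℕ → ℝ) (hy0 : 0 < y) (hy1 : y < 1)
    (h10 : ∀ h, 0 ≤ μ₁ h) (h11 : ∑ h ∈ Finset.range (M₁ + 1), μ₁ h = 1)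
    (hta1 : y * (M₁ : ℝ) ≤ q * ∑ h ∈ Finset.range (M₁ + 1), (h : ℝ) * μ₁ h)
    (h20 : ∀ h, 0 ≤ μ₂ h) (h21 : ∑ h ∈ Finset.range (M₂ + 1), μ₂ h = 1)
    (hta2 : y * (M₂ : ℝ) ≤ q * ∑ h ∈ Finset.range (M₂ + 1), (h : ℝ) * μ₂ h)
    (hd : 2 * ((0 : ℕ) : ℝ) < q * ((∑ h ∈ Finset.range (M₁ + 1), (h : ℝ) * μ₁ h) + ∑ h ∈ Finset.range (M₂ + 1), (h : ℝ) * μ₂ h)) :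
    y / (1 - y) * ∑ h ∈ Finset.range (0 + 1), gate (lconv M₁ M₂ μ₁ μ₂) q h
      ≤ ∑ h ∈ Finset.range (M₁ + M₂ + 1),
        (if q * ((∑ h ∈ Finset.range (M₁ + 1), (h : ℝ) * μ₁ h) + ∑ h ∈ Finset.range (M₂ + 1), (h : ℝ) * μ₂ h) - ((0 : ℕ) : ℝ) ≤ (h : ℝ)
          then gate (lconv M₁ M₂ μ₁ μ₂) q h else 0) := by
  set T₁ : ℝ := ∑ h ∈ Finset.range (M₁ + 1), (h : ℝ) * μ₁ h with hT₁
  set T₂ : ℝ := ∑ h ∈ Finset.range (M₂ + 1), (h : ℝ) * μ₂ h with hT₂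
  set ν := gate (lconv M₁ M₂ μ₁ μ₂) q with hν
  have ht : 0 < q * (T₁ + T₂) := by simpa using hd
  -- `i := ⌈t⌉₊ − 1` satisfies `i < t` and `[i + 1 ≤ h] ↔ [t ≤ h]`
  set i : ℕ := ⌈q * (T₁ + T₂)⌉₊ - 1 with hi
  have hceil : 1 ≤ ⌈q * (T₁ + T₂)⌉₊ := Nat.one_le_iff_ne_zero.2 (Nat.pos_iff_ne_zero.1 (Nat.ceil_pos.2 ht))
  have hi1 : i + 1 = ⌈q * (T₁ + T₂)⌉₊ := by rw [hi]; omega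
  have hilt : (i : ℝ) < q * (T₁ + T₂) := by
    have := Nat.ceil_lt_add_one ht.le
    have e : (i : ℝ) = (⌈q * (T₁ + T₂)⌉₊ : ℝ) - 1 := by
      rw [hi, Nat.cast_sub hceil, Nat.cast_one]
    rw [e]; linarith
  have main := twoLayer_gateConv_pair_zero y q M₁ M₂ μ₁ μ₂ hy0 h10 h11 hta1 h20 h21 hta2 i hilt
  -- rewrite the two sides
  have hL : ∑ h ∈ Finset.range (M₁ + M₂ + 1), (if h ≤ 0 then ν h else 0) = ∑ h ∈ Finset.range (0 + 1), ν h := by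
    rw [Finset.sum_range_one]
    rw [Finset.sum_eq_single 0 (fun h _ hne => if_neg (by omega)) (fun hno => (hno (Finset.mem_range.2 (by omega))).elim)]
    rw [if_pos le_rfl]
  have hR : ∑ h ∈ Finset.range (M₁ + M₂ + 1), (if i + 1 ≤ h then ν h else 0)
      = ∑ h ∈ Finset.range (M₁ + M₂ + 1), (if q * (T₁ + T₂) - ((0 : ℕ) : ℝ) ≤ (h : ℝ) then ν h else 0) := by
    refine Finset.sum_congr rfl fun h _ => ?_
    have e : (i + 1 ≤ h) ↔ (q * (T₁ + T₂) - ((0 : ℕ) : ℝ) ≤ (h : ℝ)) := by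
      rw [hi1, Nat.cast_zero, sub_zero]
      exact Nat.ceil_le
    simp only [e]
  rw [hL, hR] at main
  rw [div_mul_eq_mul_div, div_le_iff₀ (by linarith)]
  linarith [main]

end LawDec

end Quant

end Summit.CriticalPhenomena.PercolationContinuityZ3.Theorems
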